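import Mathlib.Analysis.Complex.CauchyIntegral
import Mathlib.Analysis.SpecialFunctions.Gaussian.GaussianIntegral
import Mathlib.Probability.Distributions.Gaussian.Real
import Mathlib.Analysis.SpecialFunctions.Trigonometric.Series
import Mathlib.Analysis.SpecialFunctions.Trigonometric.Bounds
import Mathlib.Analysis.SpecialFunctions.Trigonometric.DerivHyp
import Mathlib.Analysis.Complex.ExponentialBounds
import HarnessLib

/-!
# The heat kernel of the continuous-time simple random walk on `ℤ`: Chernoff and Gaussian bounds

Topic `Probability/LatticeModels`, companion of `LatticeGreenFunction.lean` on the way to the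
classical asymptotics `G(x) = a_d |x|^{2-d} + O(|x|^{-d})` of the Green function of simple random
walk on `ℤ^d`, `d ≥ 3` (Lawler–Limic 2010, Thm. 4.3.1), file `LatticeGreenAsymptotics.lean`.
The route taken there is the local central limit theorem with Gaussian-weighted errors for the
*continuous-time* walk, whose `d`-dimensional transition function is the product of `d`
one-dimensional ones; this file supplies the one-dimensional kernel

* `srwHeatKernel t m = (1/2π) ∫_{-π}^{π} cos(km) e^{-t(1 - cos k)} dk` (`= e^{-t} I_m(t)`, the
  transition function at time `t` of the rate-one continuous-time simple random walk on `ℤ`, i.e.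
  jumps `±1` at rate `1/2` each), and the Gaussian kernel
  `gaussHeatKernel t m = (2πt)^{-1/2} e^{-m²/(2t)}` — a real-parameter wrapper (variance `t : ℝ`,
  junk value `0` for `t ≤ 0`) of Mathlib's `ProbabilityTheory.gaussianPDFReal 0 ⟨t, _⟩ m`
  (`gaussHeatKernel_eq_gaussianPDFReal`; on `ℝ` it is also the tree's
  `Literature.Analysis.UnboundedOperators.heatKernel (t/2)`), kept because the local limit theorem
  of the companion file manipulates `t ↦ t^{-1/2}, t^{-3/2}` over all real `t ≥ 1`,

and PROVES, by ONE contour shift `k ↦ k + iλ` of the `2π`-periodic entire integrand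
`e^{ikm} e^{-t(1 - cos k)}` (Cauchy–Goursat on a rectangle, the vertical sides cancelling by
periodicity) — the Fourier form of the Chernoff bound —

* `abs_srwHeatKernel_le_exp` : `|q_t(m)| ≤ e^{-λm + t(cosh λ - 1)} (1 ∨ t)^{-1/2}`;
* `srwHeatKernel_decay` : for every `p : ℕ` a constant `A` with
  `|q_t(m)| ≤ A (1 ∨ t)^{-1/2} (1 + m²/(1 ∨ t))^{-p}` for all `t > 0`, `m ∈ ℤ`
  (`λ = m/t` for `|m| ≤ t`, `λ = 1` beyond; `cosh λ - 1 ≤ (7/8)λ²` on `[0,1]`).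

The companion file `SRWHeatKernelLCLT.lean` proves by the same shift the Gaussian-weighted local
limit theorem `|q_t(m) - φ_t(m)| ≤ B t^{-3/2}(1 + m²/t)^{-p}` (`t ≥ 1`).

## References

* G. F. Lawler, V. Limic, *Random Walk: A Modern Introduction*, CUP 2010, §2.3 (LCLT with
  exponential/Gaussian error weights) and Thm. 4.3.1 [LawlerLimic2010].
* G. F. Lawler, *Intersections of Random Walks*, Birkhäuser 1991, §1.2 and Thm. 1.5.4 [Lawler1991].

## Mathlib

Used: Cauchy–Goursat for rectangles (`Complex.integral_boundary_rect_eq_zero_of_differentiableOn`),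
`Real.cosh_le_exp_half_sq`, `Real.pow_div_factorial_le_exp`, Jordan's inequality
`Real.cos_le_one_sub_mul_cos_sq`, `integral_gaussian`, and the Gaussian density
`ProbabilityTheory.gaussianPDFReal` (of which `gaussHeatKernel` is a wrapper, see above). Mathlib has
no random-walk (modified-Bessel) heat kernel (searched `heatKernel`, `besselI`, `randomWalk`).
-/

noncomputable section

open MeasureTheory Set Filter intervalIntegral
open scoped Real Topology

namespace Literature.Probability.LatticeModels

/-! ### Definitions -/

/-- The heat kernel of the rate-one continuous-time simple random walk on `ℤ` (jumps `±1` at rate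
`1/2` each), in Fourier form: `q_t(m) = (1/2π) ∫_{-π}^{π} cos(km) e^{-t(1 - cos k)} dk`
(`= e^{-t} I_m(t)` with the modified Bessel function `I_m`). [folklore] -/
def srwHeatKernel (t : ℝ) (m : ℤ) : ℝ :=
  (∫ k in (-π)..π, Real.cos (k * m) * Real.exp (-(t * (1 - Real.cos k)))) / (2 * π)

/-- The Gaussian heat kernel of variance `t`: `φ_t(m) = (2πt)^{-1/2} e^{-m²/(2t)}`, with the
variance a REAL parameter: for `0 ≤ t` this is Mathlib's centred Gaussian density
`ProbabilityTheory.gaussianPDFReal 0 ⟨t, _⟩ m` (`gaussHeatKernel_eq_gaussianPDFReal`), and on `ℝ`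
the tree's `Literature.Analysis.UnboundedOperators.heatKernel (t/2) m`; for `t ≤ 0` it takes the junk
value `0` (`Real.sqrt` of a nonpositive number is `0` and `x/0 = 0`; `gaussHeatKernel_of_nonpos`).
The wrapper exists only so that the `t^{-1/2}`/`t^{-3/2}` estimates of `SRWHeatKernelLCLT.lean` can
be stated over real `t ≥ 1` without `ℝ≥0` coercions. [folklore] -/
def gaussHeatKernel (t m : ℝ) : ℝ :=
  Real.exp (-(m ^ 2 / (2 * t))) / Real.sqrt (2 * π * t)

/-- `gaussHeatKernel` IS Mathlib's Gaussian density: for `0 ≤ t`,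
`gaussHeatKernel t m = gaussianPDFReal 0 ⟨t, _⟩ m`. [folklore] -/
theorem gaussHeatKernel_eq_gaussianPDFReal {t : ℝ} (ht : 0 ≤ t) (m : ℝ) :
    gaussHeatKernel t m = ProbabilityTheory.gaussianPDFReal 0 ⟨t, ht⟩ m := by
  unfold gaussHeatKernel ProbabilityTheory.gaussianPDFReal
  simp only [sub_zero]
  rw [div_eq_inv_mul, neg_div]
  rfl

/-- The junk value: `gaussHeatKernel t m = 0` for `t ≤ 0`. [folklore] -/
theorem gaussHeatKernel_of_nonpos {t : ℝ} (ht : t ≤ 0) (m : ℝ) : gaussHeatKernel t m = 0 := by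
  unfold gaussHeatKernel
  have : Real.sqrt (2 * π * t) = 0 :=
    Real.sqrt_eq_zero'.2 (mul_nonpos_of_nonneg_of_nonpos (by positivity) ht)
  rw [this, div_zero]

/-- The entire, `2π`-periodic integrand `F_{t,m}(z) = e^{izm} e^{-t(1 - cos z)}` whose integral
over `[-π, π]` is `2π q_t(m)`. [folklore] -/
def srwHeatIntegrand (t : ℝ) (m : ℤ) (z : ℂ) : ℂ :=
  Complex.exp (Complex.I * z * m) * Complex.exp (-(t : ℂ) * (1 - Complex.cos z))

/-! ### Elementary properties -/

/-- `q_t` is even in `m`. [folklore] -/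
theorem srwHeatKernel_neg (t : ℝ) (m : ℤ) : srwHeatKernel t (-m) = srwHeatKernel t m := by
  unfold srwHeatKernel
  simp [mul_neg, Real.cos_neg]

/-- `φ_t` is even. [folklore] -/
theorem gaussHeatKernel_neg (t m : ℝ) : gaussHeatKernel t (-m) = gaussHeatKernel t m := by
  unfold gaussHeatKernel
  simp

/-- `φ_t ≥ 0`. [folklore] -/
theorem gaussHeatKernel_nonneg (t m : ℝ) : 0 ≤ gaussHeatKernel t m := by
  unfold gaussHeatKernel
  positivity

/-- The real integrand is continuous in `k`. [folklore] -/
theorem continuous_srwHeatKernel_integrand (t : ℝ) (m : ℤ) :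
    Continuous fun k : ℝ => Real.cos (k * m) * Real.exp (-(t * (1 - Real.cos k))) := by
  fun_prop

/-- `|q_t(m)| ≤ 1` for `t ≥ 0` (the integrand is bounded by `1`). [folklore] -/
theorem abs_srwHeatKernel_le_one {t : ℝ} (ht : 0 ≤ t) (m : ℤ) : |srwHeatKernel t m| ≤ 1 := by
  unfold srwHeatKernel
  have hπ : 0 < 2 * π := by positivity
  rw [abs_div, abs_of_pos hπ, div_le_one hπ]
  have hle : (-π : ℝ) ≤ π := by linarith [Real.pi_pos]
  calc |∫ k in (-π)..π, Real.cos (k * m) * Real.exp (-(t * (1 - Real.cos k)))|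
      ≤ ∫ _ in (-π)..π, (1 : ℝ) := by
        refine intervalIntegral.abs_integral_le_integral_abs hle |>.trans ?_
        refine intervalIntegral.integral_mono_on hle ?_ (by simp) fun k _ => ?_
        · exact ((continuous_srwHeatKernel_integrand t m).abs).intervalIntegrable _ _
        · rw [abs_mul, Real.abs_exp]
          have h1 : |Real.cos (k * m)| ≤ 1 := Real.abs_cos_le_one _
          have h2 : Real.exp (-(t * (1 - Real.cos k))) ≤ 1 := by
            rw [Real.exp_le_one_iff, neg_nonpos]
            exact mul_nonneg ht (sub_nonneg.2 (Real.cos_le_one k))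
          calc |Real.cos (k * m)| * Real.exp (-(t * (1 - Real.cos k)))
              ≤ 1 * 1 := mul_le_mul h1 h2 (Real.exp_pos _).le zero_le_one
            _ = 1 := one_mul 1
    _ = 2 * π := by simp; ring

/-! ### The complex integrand -/

/-- On the real axis, `F_{t,m}(k) = e^{-t(1-cos k)}(cos(km) + i sin(km))`. [folklore] -/
theorem srwHeatIntegrand_ofReal (t : ℝ) (m : ℤ) (k : ℝ) :
    srwHeatIntegrand t m k =
      ((Real.cos (k * m) * Real.exp (-(t * (1 - Real.cos k))) : ℝ) : ℂ) +
        ((Real.sin (k * m) * Real.exp (-(t * (1 - Real.cos k))) : ℝ) : ℂ) * Complex.I := by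
  unfold srwHeatIntegrand
  have h1 : Complex.exp (Complex.I * (k : ℂ) * (m : ℂ)) =
      (Real.cos (k * m) : ℂ) + (Real.sin (k * m) : ℂ) * Complex.I := by
    rw [show Complex.I * (k : ℂ) * (m : ℂ) = ((k * m : ℝ) : ℂ) * Complex.I by push_cast; ring,
      Complex.exp_mul_I]
    push_cast
    ring
  have h2 : Complex.exp (-(t : ℂ) * (1 - Complex.cos k)) =
      ((Real.exp (-(t * (1 - Real.cos k))) : ℝ) : ℂ) := by
    rw [Complex.ofReal_exp]
    push_cast
    rw [← Complex.ofReal_cos]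
    ring_nf
  rw [h1, h2]
  push_cast
  ring

/-- The sine part integrates to zero over `[-π, π]` (odd integrand). [folklore] -/
theorem integral_sin_mul_exp_eq_zero (t : ℝ) (m : ℤ) :
    ∫ k in (-π)..π, Real.sin (k * m) * Real.exp (-(t * (1 - Real.cos k))) = 0 := by
  set g : ℝ → ℝ := fun k => Real.sin (k * m) * Real.exp (-(t * (1 - Real.cos k))) with hg
  have hodd : ∀ k, g (-k) = -g k := fun k => by
    simp only [hg, neg_mul, Real.sin_neg, Real.cos_neg]
  have h1 : ∫ k in (-π)..π, g (-k) = ∫ k in (-π)..π, g k := by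
    rw [intervalIntegral.integral_comp_neg]
    simp
  have h2 : ∫ k in (-π)..π, g (-k) = -∫ k in (-π)..π, g k := by
    simp_rw [hodd]
    exact intervalIntegral.integral_neg
  change ∫ k in (-π)..π, g k = 0
  linarith

/-- **`∫_{-π}^{π} F_{t,m}(k) dk = 2π q_t(m)`** (the imaginary part vanishes by oddness). [folklore] -/
theorem integral_srwHeatIntegrand (t : ℝ) (m : ℤ) :
    ∫ k in (-π)..π, srwHeatIntegrand t m k = ((2 * π * srwHeatKernel t m : ℝ) : ℂ) := by
  have hc1 := continuous_srwHeatKernel_integrand t m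
  have hc2 : Continuous fun k : ℝ => Real.sin (k * m) * Real.exp (-(t * (1 - Real.cos k))) := by
    fun_prop
  simp_rw [srwHeatIntegrand_ofReal]
  rw [intervalIntegral.integral_add, intervalIntegral.integral_mul_const,
    intervalIntegral.integral_ofReal, intervalIntegral.integral_ofReal,
    integral_sin_mul_exp_eq_zero]
  · simp only [Complex.ofReal_zero, zero_mul, add_zero]
    congr 1
    unfold srwHeatKernel
    have hπ : (2 * π : ℝ) ≠ 0 := by positivity
    rw [mul_div_cancel₀ _ hπ]
  · exact (Complex.continuous_ofReal.comp hc1).intervalIntegrable _ _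
  · exact ((Complex.continuous_ofReal.comp hc2).mul continuous_const).intervalIntegrable _ _

/-- `F_{t,m}` is `2π`-periodic (`m ∈ ℤ`). [folklore] -/
theorem srwHeatIntegrand_add_two_pi (t : ℝ) (m : ℤ) (z : ℂ) :
    srwHeatIntegrand t m (z + 2 * π) = srwHeatIntegrand t m z := by
  unfold srwHeatIntegrand
  rw [Complex.cos_add_two_pi]
  congr 1
  rw [show Complex.I * (z + 2 * π) * (m : ℂ) = Complex.I * z * m + m * (2 * π * Complex.I) by ring,
    Complex.exp_add, Complex.exp_int_mul_two_pi_mul_I, mul_one]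

/-- `F_{t,m}` is entire. [folklore] -/
theorem differentiable_srwHeatIntegrand (t : ℝ) (m : ℤ) :
    Differentiable ℂ (srwHeatIntegrand t m) := by
  unfold srwHeatIntegrand
  fun_prop

/-- **The contour shift** `∫_{-π}^{π} F(k) dk = ∫_{-π}^{π} F(k + iλ) dk`: Cauchy–Goursat on the
rectangle `[-π, π] × [0, λ]`, the two vertical sides cancelling by `2π`-periodicity. [folklore] -/
theorem integral_srwHeatIntegrand_shift (t : ℝ) (m : ℤ) (lam : ℝ) :
    ∫ k in (-π)..π, srwHeatIntegrand t m k =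
      ∫ k in (-π)..π, srwHeatIntegrand t m ((k : ℂ) + lam * Complex.I) := by
  -- the vertical sides coincide by periodicity
  have hper : ∀ y : ℝ, srwHeatIntegrand t m ((π : ℝ) + y * Complex.I) =
      srwHeatIntegrand t m (((-π : ℝ) : ℂ) + y * Complex.I) := by
    intro y
    rw [← srwHeatIntegrand_add_two_pi t m (((-π : ℝ) : ℂ) + y * Complex.I)]
    congr 1
    push_cast
    ring
  have h := Complex.integral_boundary_rect_eq_zero_of_differentiableOn (srwHeatIntegrand t m)
    (-π : ℝ) ((π : ℝ) + lam * Complex.I) ((differentiable_srwHeatIntegrand t m).differentiableOn)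
  simp only [Complex.ofReal_re, Complex.ofReal_im, Complex.add_re, Complex.add_im, Complex.mul_re,
    Complex.mul_im, Complex.I_re, Complex.I_im, mul_zero, mul_one, zero_mul, sub_zero, add_zero,
    Complex.ofReal_zero, zero_add] at h
  simp_rw [hper] at h
  have h' : (∫ x : ℝ in (-π)..π, srwHeatIntegrand t m x) -
      ∫ x : ℝ in (-π)..π, srwHeatIntegrand t m (x + lam * Complex.I) = 0 := by
    linear_combination h
  exact sub_eq_zero.1 h'

/-- The real part of `1 - cos(k + iλ)` is `1 - cos k cosh λ`. [folklore] -/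
theorem one_sub_cos_add_mul_I_re (k lam : ℝ) :
    (1 - Complex.cos ((k : ℂ) + lam * Complex.I)).re = 1 - Real.cos k * Real.cosh lam := by
  rw [Complex.cos_add, Complex.cos_mul_I, Complex.sin_mul_I]
  simp [Complex.cos_ofReal_re, Complex.sin_ofReal_re, Complex.cosh_ofReal_re, Complex.sinh_ofReal_re,
    Complex.cos_ofReal_im, Complex.sin_ofReal_im, Complex.cosh_ofReal_im, Complex.sinh_ofReal_im]

/-- **The shifted integrand in modulus**: `|F(k + iλ)| = e^{-λm} e^{-t(1 - cos k cosh λ)}`.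
[folklore] -/
theorem norm_srwHeatIntegrand_shift (t : ℝ) (m : ℤ) (k lam : ℝ) :
    ‖srwHeatIntegrand t m ((k : ℂ) + lam * Complex.I)‖ =
      Real.exp (-(lam * m)) * Real.exp (-(t * (1 - Real.cos k * Real.cosh lam))) := by
  unfold srwHeatIntegrand
  rw [norm_mul, Complex.norm_exp, Complex.norm_exp]
  congr 1
  · congr 1
    simp [Complex.mul_re, Complex.mul_im]
  · congr 1
    have h := one_sub_cos_add_mul_I_re k lam
    rw [Complex.mul_re, h]
    simp only [Complex.neg_re, Complex.ofReal_re, Complex.neg_im, Complex.ofReal_im, neg_zero,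
      zero_mul, sub_zero]
    ring

/-! ### Gaussian comparison integrals on `[-π, π]` -/

/-- Jordan: `e^{-t(1 - cos k)} ≤ e^{-(2t/π²)k²}` on `[-π, π]` for `t ≥ 0`. [folklore] -/
theorem exp_neg_mul_one_sub_cos_le {t k : ℝ} (ht : 0 ≤ t) (hk : |k| ≤ π) :
    Real.exp (-(t * (1 - Real.cos k))) ≤ Real.exp (-(2 * t / π ^ 2) * k ^ 2) := by
  rw [Real.exp_le_exp]
  have h := Real.cos_le_one_sub_mul_cos_sq hk
  have : 2 / π ^ 2 * k ^ 2 ≤ 1 - Real.cos k := by linarith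
  have := mul_le_mul_of_nonneg_left this ht
  have e : t * (2 / π ^ 2 * k ^ 2) = (2 * t / π ^ 2) * k ^ 2 := by ring
  linarith

/-- `∫_{-π}^{π} e^{-t(1 - cos k)} dk ≤ 2π (1 ∨ t)^{-1/2}` for `t ≥ 0`: bounded by `2π` trivially and,
through Jordan's inequality, by the Gaussian integral `∫_ℝ e^{-(2t/π²)k²} dk = π^{3/2}/√(2t)`.
[folklore] -/
theorem integral_exp_neg_mul_one_sub_cos_le {t : ℝ} (ht : 0 ≤ t) :
    ∫ k in (-π)..π, Real.exp (-(t * (1 - Real.cos k))) ≤ 2 * π * (max 1 t) ^ (-(1 / 2 : ℝ)) := by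
  have hle : (-π : ℝ) ≤ π := by linarith [Real.pi_pos]
  have hcont : Continuous fun k : ℝ => Real.exp (-(t * (1 - Real.cos k))) := by fun_prop
  have hπ := Real.pi_pos
  -- the trivial bound
  have htriv : ∫ k in (-π)..π, Real.exp (-(t * (1 - Real.cos k))) ≤ 2 * π := by
    calc ∫ k in (-π)..π, Real.exp (-(t * (1 - Real.cos k))) ≤ ∫ _ in (-π)..π, (1 : ℝ) := by
          refine intervalIntegral.integral_mono_on hle (hcont.intervalIntegrable _ _) (by simp)
            fun k _ => ?_
          rw [Real.exp_le_one_iff, neg_nonpos]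
          exact mul_nonneg ht (sub_nonneg.2 (Real.cos_le_one k))
      _ = 2 * π := by simp; ring
  rcases le_or_gt t 1 with h1 | h1
  · rw [max_eq_left h1, Real.one_rpow, mul_one]
    exact htriv
  · rw [max_eq_right h1.le]
    have ht0 : 0 < t := by linarith
    set b : ℝ := 2 * t / π ^ 2 with hb
    have hb0 : 0 < b := by positivity
    have hgi := integrable_exp_neg_mul_sq hb0
    calc ∫ k in (-π)..π, Real.exp (-(t * (1 - Real.cos k)))
        ≤ ∫ k in (-π)..π, Real.exp (-b * k ^ 2) := by
          refine intervalIntegral.integral_mono_on hle (hcont.intervalIntegrable _ _)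
            (hgi.intervalIntegrable) fun k hk => ?_
          exact exp_neg_mul_one_sub_cos_le ht (abs_le.2 ⟨by linarith [hk.1], hk.2⟩)
      _ ≤ ∫ k, Real.exp (-b * k ^ 2) := by
          rw [intervalIntegral.integral_of_le hle]
          exact setIntegral_le_integral hgi (Eventually.of_forall fun k => (Real.exp_pos _).le)
      _ = Real.sqrt (π / b) := integral_gaussian b
      _ ≤ 2 * π * t ^ (-(1 / 2 : ℝ)) := by
          -- `√(π³/(2t)) ≤ 2π/√t` since `π ≤ 8`
          have hsq : Real.sqrt (π / b) = Real.sqrt (π ^ 3 / 2) * t ^ (-(1 / 2 : ℝ)) := by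
            rw [hb, show π / (2 * t / π ^ 2) = (π ^ 3 / 2) * t⁻¹ by field_simp,
              Real.sqrt_mul (by positivity), Real.sqrt_inv, Real.rpow_neg ht0.le,
              Real.sqrt_eq_rpow t]
          rw [hsq]
          refine mul_le_mul_of_nonneg_right ?_ (Real.rpow_nonneg ht0.le _)
          rw [Real.sqrt_le_left (by positivity)]
          have hπ3 : π ≤ 4 := Real.pi_le_four
          nlinarith

/-- Splitting off the `λ`-dependence: `e^{-t(1 - cos k cosh λ)} ≤ e^{t(cosh λ - 1)} e^{-t(1 - cos k)}`
for `t ≥ 0` (since `cosh λ ≥ 1` and `1 - cos k ≥ 0`). [folklore] -/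
theorem exp_neg_mul_one_sub_cos_mul_cosh_le {t : ℝ} (ht : 0 ≤ t) (k lam : ℝ) :
    Real.exp (-(t * (1 - Real.cos k * Real.cosh lam))) ≤
      Real.exp (t * (Real.cosh lam - 1)) * Real.exp (-(t * (1 - Real.cos k))) := by
  rw [← Real.exp_add, Real.exp_le_exp]
  have h1 : 1 ≤ Real.cosh lam := Real.one_le_cosh lam
  have h2 : 0 ≤ 1 - Real.cos k := sub_nonneg.2 (Real.cos_le_one k)
  nlinarith [mul_nonneg ht (mul_nonneg (sub_nonneg.2 h1) h2)]

/-! ### The Chernoff bound -/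

/-- **Chernoff bound in Fourier form**: for `t ≥ 0`, `m ∈ ℤ` and every real `λ`,
`|q_t(m)| ≤ e^{-λm + t(cosh λ - 1)} (1 ∨ t)^{-1/2}`. [folklore] -/
theorem abs_srwHeatKernel_le_exp {t : ℝ} (ht : 0 ≤ t) (m : ℤ) (lam : ℝ) :
    |srwHeatKernel t m| ≤
      Real.exp (-(lam * m) + t * (Real.cosh lam - 1)) * (max 1 t) ^ (-(1 / 2 : ℝ)) := by
  have hle : (-π : ℝ) ≤ π := by linarith [Real.pi_pos]
  have hπ : 0 < 2 * π := by positivity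
  -- `2π |q| = ‖∫ F(k + iλ)‖ ≤ ∫ ‖F(k + iλ)‖`
  have hnorm : 2 * π * |srwHeatKernel t m| =
      ‖∫ k in (-π)..π, srwHeatIntegrand t m ((k : ℂ) + lam * Complex.I)‖ := by
    rw [← integral_srwHeatIntegrand_shift, integral_srwHeatIntegrand, Complex.norm_real,
      Real.norm_eq_abs, abs_mul, abs_of_pos hπ]
  have hcont : Continuous fun k : ℝ => srwHeatIntegrand t m ((k : ℂ) + lam * Complex.I) :=
    (differentiable_srwHeatIntegrand t m).continuous.comp (by fun_prop)
  have hbound : ‖∫ k in (-π)..π, srwHeatIntegrand t m ((k : ℂ) + lam * Complex.I)‖ ≤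
      Real.exp (-(lam * m) + t * (Real.cosh lam - 1)) * (2 * π * (max 1 t) ^ (-(1 / 2 : ℝ))) := by
    calc ‖∫ k in (-π)..π, srwHeatIntegrand t m ((k : ℂ) + lam * Complex.I)‖
        ≤ ∫ k in (-π)..π, ‖srwHeatIntegrand t m ((k : ℂ) + lam * Complex.I)‖ :=
          intervalIntegral.norm_integral_le_integral_norm hle
      _ ≤ ∫ k in (-π)..π, Real.exp (-(lam * m) + t * (Real.cosh lam - 1)) *
            Real.exp (-(t * (1 - Real.cos k))) := by
          refine intervalIntegral.integral_mono_on hle (hcont.norm.intervalIntegrable _ _)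
            (Continuous.intervalIntegrable (by fun_prop) _ _) fun k _ => ?_
          rw [norm_srwHeatIntegrand_shift, Real.exp_add, mul_assoc]
          exact mul_le_mul_of_nonneg_left (exp_neg_mul_one_sub_cos_mul_cosh_le ht k lam)
            (Real.exp_pos _).le
      _ = Real.exp (-(lam * m) + t * (Real.cosh lam - 1)) *
            ∫ k in (-π)..π, Real.exp (-(t * (1 - Real.cos k))) := by
          rw [intervalIntegral.integral_const_mul]
      _ ≤ Real.exp (-(lam * m) + t * (Real.cosh lam - 1)) * (2 * π * (max 1 t) ^ (-(1 / 2 : ℝ))) :=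
          mul_le_mul_of_nonneg_left (integral_exp_neg_mul_one_sub_cos_le ht) (Real.exp_pos _).le
  rw [← hnorm] at hbound
  have : 2 * π * |srwHeatKernel t m| ≤
      2 * π * (Real.exp (-(lam * m) + t * (Real.cosh lam - 1)) * (max 1 t) ^ (-(1 / 2 : ℝ))) := by
    linarith
  exact le_of_mul_le_mul_left this hπ

/-! ### Elementary real inequalities -/

/-- `e^{1/2} ≤ 7/4` (since `e < 2.72 < 49/16`). [folklore] -/
theorem exp_half_le : Real.exp (1 / 2) ≤ 7 / 4 := by
  have h : Real.exp (1 / 2) ^ 2 = Real.exp 1 := by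
    rw [← Real.exp_nat_mul]; norm_num
  have h1 : Real.exp 1 < (7 / 4 : ℝ) ^ 2 := by
    have := Real.exp_one_lt_d9; norm_num at this ⊢; linarith
  nlinarith [Real.exp_pos (1 / 2)]

/-- **`cosh λ - 1 ≤ (7/8) λ²` for `|λ| ≤ 1`**: `cosh λ ≤ e^{λ²/2}` (Mathlib), `e^u - 1 ≤ u e^u` and
`e^{1/2} ≤ 7/4`. [folklore] -/
theorem cosh_sub_one_le {lam : ℝ} (h : |lam| ≤ 1) : Real.cosh lam - 1 ≤ 7 / 8 * lam ^ 2 := by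
  have hu0 : 0 ≤ lam ^ 2 / 2 := by positivity
  have hu1 : lam ^ 2 / 2 ≤ 1 / 2 := by
    have : lam ^ 2 ≤ 1 := by
      have := abs_le.1 h
      nlinarith
    linarith
  have h1 : Real.cosh lam ≤ Real.exp (lam ^ 2 / 2) := Real.cosh_le_exp_half_sq lam
  -- `e^u - 1 ≤ u e^u` from `1 - u ≤ e^{-u}`
  have h2 : Real.exp (lam ^ 2 / 2) - 1 ≤ lam ^ 2 / 2 * Real.exp (lam ^ 2 / 2) := by
    have h3 : -(lam ^ 2 / 2) + 1 ≤ Real.exp (-(lam ^ 2 / 2)) := Real.add_one_le_exp _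
    have h4 : Real.exp (-(lam ^ 2 / 2)) * Real.exp (lam ^ 2 / 2) = 1 := by
      rw [← Real.exp_add]; simp
    nlinarith [Real.exp_pos (lam ^ 2 / 2), Real.exp_pos (-(lam ^ 2 / 2))]
  have h5 : Real.exp (lam ^ 2 / 2) ≤ 7 / 4 :=
    (Real.exp_le_exp.2 hu1).trans exp_half_le
  nlinarith

/-- `(1 + u)^p e^{-u/8} ≤ 8^p p! e^{1/8}` for `u ≥ 0` (from `y^p/p! ≤ e^y` at `y = (1+u)/8`).
[folklore] -/
theorem one_add_pow_mul_exp_neg_le (p : ℕ) {u : ℝ} (hu : 0 ≤ u) :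
    (1 + u) ^ p * Real.exp (-(u / 8)) ≤ 8 ^ p * p.factorial * Real.exp (1 / 8) := by
  have hy : 0 ≤ (1 + u) / 8 := by positivity
  have h := Real.pow_div_factorial_le_exp (hx := hy) (n := p)
  have hf : (0 : ℝ) < p.factorial := by exact_mod_cast Nat.factorial_pos p
  rw [div_le_iff₀ hf] at h
  have e1 : (1 + u) ^ p = 8 ^ p * ((1 + u) / 8) ^ p := by
    rw [← mul_pow]; congr 1; ring
  have e2 : Real.exp ((1 + u) / 8) = Real.exp (1 / 8) * Real.exp (u / 8) := by
    rw [← Real.exp_add]; congr 1; ring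
  have e3 : Real.exp (u / 8) * Real.exp (-(u / 8)) = 1 := by
    rw [← Real.exp_add]; simp
  rw [e1]
  calc 8 ^ p * ((1 + u) / 8) ^ p * Real.exp (-(u / 8))
      ≤ 8 ^ p * (Real.exp ((1 + u) / 8) * p.factorial) * Real.exp (-(u / 8)) := by
        gcongr
    _ = 8 ^ p * p.factorial * Real.exp (1 / 8) := by
        rw [e2]
        have := e3
        calc 8 ^ p * (Real.exp (1 / 8) * Real.exp (u / 8) * p.factorial) * Real.exp (-(u / 8))
            = 8 ^ p * p.factorial * Real.exp (1 / 8) * (Real.exp (u / 8) * Real.exp (-(u / 8))) := by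
              ring
          _ = _ := by rw [e3, mul_one]

/-- `(1 + m²)^p e^{-m/8} ≤ 2^p 8^{2p} (2p)!` for `m ≥ 1` (from `y^{2p}/(2p)! ≤ e^y` at `y = m/8`
and `1 + m² ≤ 2m²`). [folklore] -/
theorem one_add_sq_pow_mul_exp_neg_le (p : ℕ) {m : ℝ} (hm : 1 ≤ m) :
    (1 + m ^ 2) ^ p * Real.exp (-(m / 8)) ≤ 2 ^ p * 8 ^ (2 * p) * (2 * p).factorial := by
  have hm0 : 0 ≤ m := by linarith
  have hy : 0 ≤ m / 8 := by positivity
  have h := Real.pow_div_factorial_le_exp (hx := hy) (n := 2 * p)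
  have hf : (0 : ℝ) < (2 * p).factorial := by exact_mod_cast Nat.factorial_pos _
  rw [div_le_iff₀ hf] at h
  have h1 : (1 + m ^ 2) ^ p ≤ 2 ^ p * 8 ^ (2 * p) * (m / 8) ^ (2 * p) := by
    have : 1 + m ^ 2 ≤ 2 * m ^ 2 := by nlinarith
    calc (1 + m ^ 2) ^ p ≤ (2 * m ^ 2) ^ p := pow_le_pow_left₀ (by positivity) this p
      _ = 2 ^ p * 8 ^ (2 * p) * (m / 8) ^ (2 * p) := by
          rw [mul_pow, pow_mul, pow_mul, ← pow_mul 8, show (m : ℝ) ^ 2 = 8 ^ 2 * (m / 8) ^ 2 by ring,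
            mul_pow, ← pow_mul]
          ring
  have e3 : Real.exp (m / 8) * Real.exp (-(m / 8)) = 1 := by
    rw [← Real.exp_add]; simp
  calc (1 + m ^ 2) ^ p * Real.exp (-(m / 8))
      ≤ 2 ^ p * 8 ^ (2 * p) * (m / 8) ^ (2 * p) * Real.exp (-(m / 8)) := by
        gcongr
    _ ≤ 2 ^ p * 8 ^ (2 * p) * (Real.exp (m / 8) * (2 * p).factorial) * Real.exp (-(m / 8)) := by
        gcongr
    _ = 2 ^ p * 8 ^ (2 * p) * (2 * p).factorial * (Real.exp (m / 8) * Real.exp (-(m / 8))) := by ring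
    _ = 2 ^ p * 8 ^ (2 * p) * (2 * p).factorial := by rw [e3, mul_one]

/-! ### Gaussian-weighted decay of the heat kernel -/

/-- The two Chernoff regimes for `m ≥ 0`, `t > 0`: `|q_t(m)| ≤ e^{-m²/(8t)} (1∨t)^{-1/2}` if
`m ≤ t` (shift `λ = m/t`) and `|q_t(m)| ≤ e^{-m/8} (1∨t)^{-1/2}` if `m ≥ t` (shift `λ = 1`).
[folklore] -/
theorem abs_srwHeatKernel_le_of_nonneg {t : ℝ} (ht : 0 < t) {m : ℤ} (hm : 0 ≤ m) :
    ((m : ℝ) ≤ t → |srwHeatKernel t m| ≤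
        Real.exp (-((m : ℝ) ^ 2 / (8 * t))) * (max 1 t) ^ (-(1 / 2 : ℝ))) ∧
    (t ≤ m → |srwHeatKernel t m| ≤ Real.exp (-((m : ℝ) / 8)) * (max 1 t) ^ (-(1 / 2 : ℝ))) := by
  have hm0 : (0 : ℝ) ≤ m := by exact_mod_cast hm
  have hT : 0 ≤ (max 1 t) ^ (-(1 / 2 : ℝ)) := Real.rpow_nonneg (by positivity) _
  constructor
  · intro hmt
    have h := abs_srwHeatKernel_le_exp ht.le m (m / t)
    refine h.trans (mul_le_mul_of_nonneg_right (Real.exp_le_exp.2 ?_) hT)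
    have hl : |(m : ℝ) / t| ≤ 1 := by
      rw [abs_of_nonneg (by positivity), div_le_one ht]; exact hmt
    have hc := cosh_sub_one_le hl
    have e1 : -((m : ℝ) / t * m) = -((m : ℝ) ^ 2 / t) := by rw [div_mul_eq_mul_div, sq]
    have e2 : t * (7 / 8 * ((m : ℝ) / t) ^ 2) = 7 / 8 * ((m : ℝ) ^ 2 / t) := by
      field_simp
    have : t * (Real.cosh ((m : ℝ) / t) - 1) ≤ 7 / 8 * ((m : ℝ) ^ 2 / t) := by
      rw [← e2]; exact mul_le_mul_of_nonneg_left hc ht.le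
    have e3 : -((m : ℝ) ^ 2 / (8 * t)) = -((m : ℝ) ^ 2 / t) + 7 / 8 * ((m : ℝ) ^ 2 / t) := by
      field_simp; ring
    rw [e1, e3]
    linarith
  · intro htm
    have h := abs_srwHeatKernel_le_exp ht.le m 1
    refine h.trans (mul_le_mul_of_nonneg_right (Real.exp_le_exp.2 ?_) hT)
    have hc := cosh_sub_one_le (show |(1 : ℝ)| ≤ 1 by norm_num)
    have : t * (Real.cosh 1 - 1) ≤ t * (7 / 8) := by
      refine mul_le_mul_of_nonneg_left ?_ ht.le; simpa using hc
    linarith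

/-- **Gaussian-weighted decay of the heat kernel**: for every `p : ℕ` there is `A > 0` with
`|q_t(m)| ≤ A (1 ∨ t)^{-1/2} (1 + m²/(1 ∨ t))^{-p}` for all `t > 0`, `m ∈ ℤ`. This is the Chernoff
bound with `λ = |m|/t` (`|m| ≤ t`, Gaussian regime) and `λ = 1` (`|m| > t`, Poisson regime), the
exponential weights being traded for polynomial ones. [folklore] -/
theorem srwHeatKernel_decay (p : ℕ) : ∃ A : ℝ, 0 < A ∧ ∀ t : ℝ, 0 < t → ∀ m : ℤ,
    |srwHeatKernel t m| ≤ A * (max 1 t) ^ (-(1 / 2 : ℝ)) * ((1 + (m : ℝ) ^ 2 / max 1 t) ^ p)⁻¹ := by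
  set CA : ℝ := 8 ^ p * p.factorial * Real.exp (1 / 8) with hCA
  set CB : ℝ := 2 ^ p * 8 ^ (2 * p) * (2 * p).factorial with hCB
  have hCA0 : 0 < CA := by positivity
  have hCB0 : 0 < CB := by positivity
  refine ⟨max CA CB, lt_max_of_lt_left hCA0, ?_⟩
  -- reduce to `m ≥ 0`
  suffices H : ∀ t : ℝ, 0 < t → ∀ m : ℤ, 0 ≤ m →
      |srwHeatKernel t m| ≤ max CA CB * (max 1 t) ^ (-(1 / 2 : ℝ)) * ((1 + (m : ℝ) ^ 2 / max 1 t) ^ p)⁻¹ by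
    intro t ht m
    rcases le_or_gt 0 m with hm | hm
    · exact H t ht m hm
    · have h := H t ht (-m) (by omega)
      rw [srwHeatKernel_neg] at h
      simpa using h
  intro t ht m hm
  have hm0 : (0 : ℝ) ≤ m := by exact_mod_cast hm
  set T : ℝ := max 1 t with hT
  have hT1 : 1 ≤ T := le_max_left _ _
  have hT0 : 0 < T := by linarith
  have htT : t ≤ T := le_max_right _ _
  have hTpow : 0 < T ^ (-(1 / 2 : ℝ)) := Real.rpow_pos_of_pos hT0 _
  set u : ℝ := (m : ℝ) ^ 2 / T with hu
  have hu0 : 0 ≤ u := by positivity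
  have hw : 0 < (1 + u) ^ p := by positivity
  rw [← div_eq_mul_inv, le_div_iff₀ hw]
  obtain ⟨hA, hB⟩ := abs_srwHeatKernel_le_of_nonneg ht hm
  rcases le_or_gt (m : ℝ) t with hmt | hmt
  · -- Gaussian regime
    have h1 := hA hmt
    have h2 : Real.exp (-((m : ℝ) ^ 2 / (8 * t))) ≤ Real.exp (-(u / 8)) := by
      rw [Real.exp_le_exp, hu, neg_le_neg_iff, div_div, mul_comm T 8]
      exact div_le_div_of_nonneg_left (by positivity) (by positivity) (by nlinarith)
    have h3 := one_add_pow_mul_exp_neg_le p hu0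
    calc |srwHeatKernel t m| * (1 + u) ^ p
        ≤ Real.exp (-(u / 8)) * T ^ (-(1 / 2 : ℝ)) * (1 + u) ^ p := by
          gcongr
          exact h1.trans (mul_le_mul_of_nonneg_right h2 hTpow.le)
      _ = (1 + u) ^ p * Real.exp (-(u / 8)) * T ^ (-(1 / 2 : ℝ)) := by ring
      _ ≤ CA * T ^ (-(1 / 2 : ℝ)) := mul_le_mul_of_nonneg_right h3 hTpow.le
      _ ≤ max CA CB * T ^ (-(1 / 2 : ℝ)) := by gcongr; exact le_max_left _ _
  · -- Poisson regime: here `m ≥ 1`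
    have h1 := hB hmt.le
    have hm1 : (1 : ℝ) ≤ m := by
      have : (0 : ℤ) < m := by exact_mod_cast (ht.trans hmt)
      exact_mod_cast this
    have h2 : (1 + u) ^ p ≤ (1 + (m : ℝ) ^ 2) ^ p := by
      apply pow_le_pow_left₀ (by positivity)
      rw [hu]
      gcongr
      exact div_le_self (by positivity) hT1
    have h3 := one_add_sq_pow_mul_exp_neg_le p hm1
    calc |srwHeatKernel t m| * (1 + u) ^ p
        ≤ Real.exp (-((m : ℝ) / 8)) * T ^ (-(1 / 2 : ℝ)) * (1 + (m : ℝ) ^ 2) ^ p := by gcongr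
      _ = (1 + (m : ℝ) ^ 2) ^ p * Real.exp (-((m : ℝ) / 8)) * T ^ (-(1 / 2 : ℝ)) := by ring
      _ ≤ CB * T ^ (-(1 / 2 : ℝ)) := mul_le_mul_of_nonneg_right h3 hTpow.le
      _ ≤ max CA CB * T ^ (-(1 / 2 : ℝ)) := by gcongr; exact le_max_right _ _

end Literature.Probability.LatticeModels
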